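/-
Origin: expansion seat `planner-pub-hodgecm-pv03-g6-0`, handover #8 2026-08-18T11:07:51Z (`HOME/pub-hodgecm-pv03-g6/lean/Pv03g6/SplitAllGood.lean`, md5 c679c320, 90 lines);
landed by the gen-7 packager in gate run 28 as `HodgeCM/Model/ToyG2/SplitAllGood.lean` (import ^import Pv03g6\.TwistedNormSep\b→import HodgeCM.Model.Toy.TwistedNormSep ×1; import ^import Pv03g6\.→import HodgeCM.Model.ToyG2. ×1; import ^import ToyG2\.→import HodgeCM.Model.ToyG2. ×2).
-/
/-
Origin: pub-hodgecm-pv03-g6 (DAG-NODE PROVER #03, gen 6), 2026-08-18.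

# `SplitInput` for ALL good objects: G3′ (Hodge–Riesz), ModelAxioms 28/28 and G4 on the FULL toy universe `toyUniverse₃`

toy-g2's split engine (#34–#37) reduces `SplitInput` — and with it `HodgeRiesz X` for every good `X`, `HRProdStep`,
`(toyUniverse₃ d t).ModelAxioms` and the G4 witness on the universe of ALL good objects — to the existence, for
every good `X` and `j`, of ONE rational operator `g : L X → L X` with (`EigenSplit.rightSplit_of_diag`)
 (hg)   `g ⊗ ℂ` diagonal on the eigenbasis `eB`,
 (hsep) equal products of eigenvalues over two `j`-sets of eigen-indices ⇒ equal holomorphic counts,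
 (hR)   the right trace radical of `⋀⁴ × ⋀ʲ → ℚ` stable under `⋀ʲ g`.
This file supplies such a `g` for EVERY good `X`, uniformly and with no leaf computation: the GALOIS-TWISTED TYPE
NORM `g = tnorm α` (`Pv03g6.TwistedTypeNorm`), `α = x - β` with `β` a primitive element of the Galois hull `N` of the
atom fields and `x ∈ ℚ` generic (`Pv03g6.TwistedNormSep`):
 (hg)   `mulL_eB` (every element of `L X = ∏ F_i` acts diagonally on `eB`);
 (hR)   `trOf_map_tnorm` (`Pv03g6.TwistedNormTrace`, Lemma A: `tr ∘ ⋀ⁿ g_α = N(α)^{dim X} · tr` in every degree,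
        from `TrType X` alone) + toy-g2's `trRightRad_map_mem`;
 (hsep) the eigenvalue of `⋀ʲ g_α` on `e_S` is `∏_δ (δα)^{cntTw δ S}` (`prod_ev_tnorm`), these products separate
        the twisted type vectors `δ ↦ cntTw δ S` for generic `x` (`exists_sep_param`), and the untwisted
        component `cntTw 1 S = nhol S` is the holomorphic count.
Main results: `rightSplit_of_good`, `splitInput_holds : SplitInput`, `hodgeRiesz_of_good`,
`toyUniverse₃_modelAxioms_all (d t) : (toyUniverse₃ d t).ModelAxioms` (28/28 on the FULL universe of good objects),
`g4_witness₃` (the G4 existential, witnessed by `toyUniverse₃`), `endState₃_all`.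
-/
import Mathlib
import Summits.HodgeConjecture.HodgeCM.Model.ToyG2.TwistedNormTrace
import Summits.HodgeConjecture.HodgeCM.Model.Toy.TwistedNormSep
import Summits.HodgeConjecture.HodgeCM.Model.ToyG2.EigenSplit
import Summits.HodgeConjecture.HodgeCM.Model.ToyG2.G4FromSplits

/-! PORT of `HodgeCM/Model/ToyG2/SplitAllGood.lean` (HodgeCMPerL run 82) — verbatim mechanical port; provenance in the PORT header line. -/

noncomputable section

open TensorProduct exteriorPower Module

namespace HodgeCM.ToyG2

open HodgeCM.Toy HodgeCM.Toy.Obj Obj₂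

attribute [local instance] Classical.propDecidable

variable {X : Obj₂}

/-- **Right splittings exist for every good object, in every degree.** -/
theorem rightSplit_of_good (hX : X.Good) (j : ℕ) : ∃ W, RightSplit X j W := by
  obtain ⟨β, hβ⟩ := X.toObj.exists_primitive
  let T : Finset (X.toObj.G → ℕ) :=
    Finset.univ.image fun S : Set.powersetCard X.toObj.Idx j => fun δ => X.toObj.cntTw δ (enum X.toObj S)
  obtain ⟨x, hα0, hsepT⟩ := X.toObj.exists_sep_param β hβ T
  set α : X.toObj.N := algebraMap ℚ X.toObj.N x - β with hαdef
  refine rightSplit_of_diag (X.toObj.mulL (X.toObj.tnorm α)) (X.toObj.ev (X.toObj.tnorm α))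
    (fun s => X.toObj.mulL_eB _ s) (fun S S' h => ?_) (fun c hc => ?_)
  · rw [X.toObj.prod_ev_tnorm, X.toObj.prod_ev_tnorm] at h
    have h' : (∏ δ : X.toObj.G, (δ α) ^ X.toObj.cntTw δ (enum X.toObj S))
        = ∏ δ : X.toObj.G, (δ α) ^ X.toObj.cntTw δ (enum X.toObj S') := by
      apply (algebraMap X.toObj.N ℂ).injective
      rw [map_prod, map_prod]
      simp only [map_pow]
      exact h
    have ht := hsepT _ (Finset.mem_image_of_mem _ (Finset.mem_univ S)) _
      (Finset.mem_image_of_mem _ (Finset.mem_univ S')) h'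
    have h1 := congrFun ht 1
    simp only [Obj.cntTw_one, cnt_enum] at h1
    exact h1
  · have := trRightRad_map_mem (X.toObj.mulLEquiv (X.toObj.tnorm α) (X.toObj.tnorm_ne_zero hα0))
      ((Algebra.norm ℚ α) ^ X.dim) (fun y => trOf_map_tnorm (trType_of_good hX) α (4 + j) y) hc
    simpa only [Obj.coe_mulLEquiv] using this

/-- **toy-g2's `SplitInput` holds**: every good object admits a right splitting in the complementary degree. -/
theorem splitInput_holds : SplitInput := fun _ hX => rightSplit_of_good hX _

/-- **G3′ for ALL good objects.** -/
theorem hodgeRiesz_of_good : ∀ X : Obj₂, X.Good → HodgeRiesz X := hodgeRiesz_of_splitInput splitInput_holds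

/-- (Ported verbatim from the HodgeCMPerL package; no docstring in the source.) -/
theorem hrProdStep_holds : HRProdStep := hrProdStep_of_splitInput splitInput_holds

/-- **ModelAxioms 28/28 on the FULL universe of good objects.** -/
theorem toyUniverse₃_modelAxioms_all (d t : ℚ) : (toyUniverse₃ d t).ModelAxioms :=
  toyUniverse₃_modelAxioms_of_splitInput d t splitInput_holds

/-- **G4**, witnessed by the full toy universe `toyUniverse₃`. -/
theorem g4_witness₃ :
    ∃ U : Universe, U.ModelAxioms ∧ U.RealisationExistsPerL ∧ U.RealisationExistsFace :=
  g4_witness_of_splitInput splitInput_holds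

/-- the in-model end state on the full universe -/
theorem endState₃_all (d t : ℚ) (hd : (1 : ℚ) ≤ d) (ht : t ^ 2 = 16) :
    (toyUniverse₃ d t).PerL ∧ (toyUniverse₃ d t).PeriodThmF ∧ (toyUniverse₃ d t).W_RK4 :=
  endState₃_of_splitInput d t hd ht splitInput_holds

end HodgeCM.ToyG2
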